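import Summits.Schanuel.Schanuel.Theorems.ZilberEacBottomEdgePoints
import HarnessLib

/-!
# The exponential-polynomial regime, CXXIII: exponential points from a bottom edge WITH THE
# SECTOR ESTIMATE `Re x₀ = o(|x₀|)`

HONEST FRAMING.  Cell `pub-schanuel` (Zilber's Exponential-Algebraic Closedness, case ladder;
host summit Schanuel), seat 2, gen 35.  File CXV (b)'s `exists_expPoints_bottomEdge` re-proved
with one more conclusion exported from the construction: along the sequence of exponential
points, `|Re x₀| ≤ ε|x₀|` eventually for every `ε > 0` (`x₀ = 2πi n u_n^{-k}` with `u_n → 1`).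
This is what the pull-back by a monomial change `y₁ = y₀'^{p} y₁'^{q}` needs: the factor
`|y₀'|^{p} = e^{p Re x₀'}` is then dominated by the super-exponentially small `|y₁'|^{q}`
(O93, the complete verdict over curves with an equal-order place of non-real direction):
**`exists_expPoints_bottomEdge_sector`**.  The proof is that of file CXV (b) verbatim plus the
sector estimate.  Mantova–Masser's question (PLMS 2024 §1 p. 5) stays OPEN; EC(3,2) OPEN; NOT
Schanuel's conjecture (neither used nor implied); EAC ⇏ SC.
-/

noncomputable section

open Filter Topology Metric Complex Polynomial
open Literature.NumberTheory.Transcendental Literature.ModelTheory.Zilber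
open Literature.ModelTheory.ExponentialFields

set_option linter.dupNamespace false

namespace Summit.Schanuel.Schanuel.Theorems

section BottomEdgePointsSector

variable (F : ℂ[X][X])

/-- **EXPONENTIAL POINTS FROM A BOTTOM EDGE, WITH THE SECTOR ESTIMATE.**  As
`exists_expPoints_bottomEdge` (file CXV (b)): `F` irreducible of positive `x₁`-degree, place
`x₀ = s^{-k}`, `x₁ = Φ(s)s^{-M}` (`M ≥ 1`), `z^k = 2πi`, `Re(Φ(0)z^M) < 0`, `G ∈ ℂ[x₀, x₁, y₁][y₀]`
whose degenerate part `G₀ ≡ G(x, 0; y₀)` on the curve has two coefficients not divisible by `F`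
⟹ exponential points `(x(p_j), e^{x(p_j)})` on `{F = 0, G(x, y₁; y₀) = 0}` with
`Re x₁ ≤ −c|p_j|^{-M}`, `|x₁| ≤ C|p_j|^{-M}`, and moreover `|Re x₀| ≤ ε|x₀| = ε|p_j|^{-k}`
eventually, for every `ε > 0`. [cite: MantovaMasser2023, §1 Further remarks, p. 5 (the
exponential-polynomial regime of the question, open in general)] (new) -/
theorem exists_expPoints_bottomEdge_sector (hFirr : Irreducible F) (hn : 1 ≤ F.natDegree)
    {k : ℕ} (hk : 1 ≤ k) {M : ℕ} (hM : 1 ≤ M) {Φ : ℂ → ℂ} (hΦan : AnalyticAt ℂ Φ 0)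
    (hplace : ∀ᶠ s in 𝓝[≠] (0 : ℂ),
      (F.map (Polynomial.evalRingHom (s ^ k)⁻¹)).eval (Φ s * (s ^ M)⁻¹) = 0)
    {z : ℂ} (hz : z ^ k = 2 * Real.pi * I) (hdir : (Φ 0 * z ^ M).re < 0)
    (G : Polynomial (MvPolynomial (Fin 3) ℂ)) (G₀ : Polynomial ℂ[X][X])
    (hG₀ : ∀ x₀ x₁ y : ℂ, (F.map (Polynomial.evalRingHom x₀)).eval x₁ = 0 →
      (G₀.map (Polynomial.eval₂RingHom (Polynomial.evalRingHom x₀) x₁)).eval y =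
        (G.map (MvPolynomial.eval ![x₀, x₁, 0])).eval y)
    (h2 : ∃ i j, i < j ∧ ¬ F ∣ G₀.coeff i ∧ ¬ F ∣ G₀.coeff j) :
    ∃ (p : ℕ → ℂ) (c : ℝ), 0 < c ∧ (∀ j, p j ≠ 0) ∧ Tendsto p atTop (𝓝 0) ∧
      (∀ j, (F.map (Polynomial.evalRingHom (p j ^ k)⁻¹)).eval (Φ (p j) * (p j ^ M)⁻¹) = 0) ∧
      (∀ j, (Φ (p j) * (p j ^ M)⁻¹).re ≤ -c * ‖p j‖⁻¹ ^ M) ∧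
      (∀ j, ‖Φ (p j) * (p j ^ M)⁻¹‖ ≤ (‖Φ 0‖ + 1) * ‖p j‖⁻¹ ^ M) ∧
      (∀ j, (G.map (MvPolynomial.eval ![(p j ^ k)⁻¹, Φ (p j) * (p j ^ M)⁻¹,
        Complex.exp (Φ (p j) * (p j ^ M)⁻¹)])).eval (Complex.exp ((p j ^ k)⁻¹)) = 0) ∧
      ∀ ε > (0 : ℝ), ∀ᶠ j in atTop, |((p j ^ k)⁻¹).re| ≤ ε * ‖p j‖⁻¹ ^ k := by
  classical
  have hk0 : k ≠ 0 := by omega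
  have h2πI : (2 * Real.pi * I : ℂ) ≠ 0 := by simp [Real.pi_ne_zero, Complex.I_ne_zero]
  have hz0 : z ≠ 0 := by
    rintro rfl
    rw [zero_pow hk0] at hz
    exact h2πI hz.symm
  -- Step 1: the bottom-edge reduction `T ≡ G₀ (mod F)` and its Puiseux root (file CXV (a))
  obtain ⟨T, e, L, ψ, hTtop, hTdiff, he, hψan, hψ0, hroot⟩ :=
    exists_bottomEdge_root F hFirr hn hk M hΦan hplace h2
  -- Step 2: the edge data of `T` (file CX (a))
  obtain ⟨ν, α, hα, hEψ, hEne, hedge⟩ :=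
    exists_edgeData F hFirr hn hk M hΦan hplace T hTtop he L hψan hroot
  -- Step 3: the direction in the ramified parameter: `ζ^e = z`, `ζ^{ek} = 2πi`
  obtain ⟨ζ, hζ⟩ := IsAlgClosed.exists_pow_nat_eq z (by omega : 0 < e)
  have hζk : ζ ^ (e * k) = 2 * Real.pi * I := by rw [pow_mul, hζ, hz]
  have hek : 1 ≤ e * k := Nat.one_le_iff_ne_zero.2 (Nat.mul_ne_zero (by omega) hk0)
  -- Step 4: the perturbation, holomorphic and small in the sector (file CX (b))
  obtain ⟨ρ, hρ0, hΦd⟩ : ∃ ρ > 0, ∀ w : ℂ, ‖w‖ < ρ → DifferentiableAt ℂ Φ w := by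
    obtain ⟨ρ, hρ0, h⟩ := Metric.eventually_nhds_iff.1 hΦan.eventually_analyticAt
    exact ⟨ρ, hρ0, fun w hw => (h (by rwa [dist_zero_right])).differentiableAt⟩
  have hPd : ∀ σ Y : ℂ, σ ≠ 0 → ‖σ‖ < min 1 ρ →
      DifferentiableAt ℂ (fun q : ℂ × ℂ => (q.1 ^ ν)⁻¹ *
        ((G.map (MvPolynomial.eval ![((q.1 ^ e) ^ k)⁻¹, Φ (q.1 ^ e) * ((q.1 ^ e) ^ M)⁻¹,
            Complex.exp (Φ (q.1 ^ e) * ((q.1 ^ e) ^ M)⁻¹)])).eval (q.1 ^ L * q.2) -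
         (G.map (MvPolynomial.eval ![((q.1 ^ e) ^ k)⁻¹, Φ (q.1 ^ e) * ((q.1 ^ e) ^ M)⁻¹, 0])).eval
            (q.1 ^ L * q.2))) (σ, Y) :=
    fun σ Y hσ0 hσ => degeneratePerturbation_differentiableAt hΦd e k M he G ν L hσ0
      (hσ.trans_le (min_le_left _ _)) (hσ.trans_le (min_le_right _ _)) Y
  have hPs : ∀ R > 0, ∀ ε > 0, ∃ δ > 0, ∃ η > 0, ∀ (t : ℝ) (u Y : ℂ), 0 < t → t < δ →
      ‖u - 1‖ < η → ‖Y‖ ≤ R →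
      ‖(fun σ Y : ℂ => (σ ^ ν)⁻¹ *
        ((G.map (MvPolynomial.eval ![((σ ^ e) ^ k)⁻¹, Φ (σ ^ e) * ((σ ^ e) ^ M)⁻¹,
            Complex.exp (Φ (σ ^ e) * ((σ ^ e) ^ M)⁻¹)])).eval (σ ^ L * Y) -
         (G.map (MvPolynomial.eval ![((σ ^ e) ^ k)⁻¹, Φ (σ ^ e) * ((σ ^ e) ^ M)⁻¹, 0])).eval
            (σ ^ L * Y))) (ζ⁻¹ * t * u) Y‖ < ε := by
    intro R hR ε hε
    obtain ⟨δ, hδ, η, hη, h⟩ :=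
      degeneratePerturbation_small (k := k) hΦan.continuousAt he hM hζ hz0 hdir G ν L R hR ε hε
    exact ⟨δ, hδ, η, hη, fun t u Y ht htδ hu hY => h t u Y _ ht htδ hu hY rfl⟩
  -- Step 5: the abstract perturbation theorem (file CVIII (b))
  obtain ⟨N₀, u, s, -, hu1, -, hs, hs0, hs0', hsol⟩ :=
    exists_expPoints_perturbedEdge (P := fun σ Y : ℂ => (σ ^ ν)⁻¹ *
        ((G.map (MvPolynomial.eval ![((σ ^ e) ^ k)⁻¹, Φ (σ ^ e) * ((σ ^ e) ^ M)⁻¹,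
            Complex.exp (Φ (σ ^ e) * ((σ ^ e) ^ M)⁻¹)])).eval (σ ^ L * Y) -
         (G.map (MvPolynomial.eval ![((σ ^ e) ^ k)⁻¹, Φ (σ ^ e) * ((σ ^ e) ^ M)⁻¹, 0])).eval
            (σ ^ L * Y)))
      hek L hζk T.natDegree hα hψ0 hEψ hEne (lt_min one_pos hρ0) hPd hPs
  -- Step 6: thresholds along the sequence
  have hsW : Tendsto s atTop (𝓝[≠] (0 : ℂ)) :=
    tendsto_nhdsWithin_iff.2 ⟨hs0', Eventually.of_forall hs0⟩
  have hseW : Tendsto (fun j => s j ^ e) atTop (𝓝[≠] (0 : ℂ)) :=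
    (tendsto_pow_puncturedNhds_zero e he).comp hsW
  have he0 : (0 : ℂ) ^ e = 0 := zero_pow (by omega)
  have hΦc' : ContinuousAt (fun σ : ℂ => Φ (σ ^ e)) 0 :=
    hΦan.continuousAt.comp_of_eq (continuous_pow e).continuousAt (by simp [he0])
  have hdir' : ((fun σ : ℂ => Φ (σ ^ e)) 0 * z ^ M).re < 0 := by
    simp only [he0]
    exact hdir
  obtain ⟨c, hc, δ₁, hδ₁, η₁, hη₁, hdirc⟩ := exists_direction_const hΦc' (z ^ M) (e * M) hdir'
  have hΦb : ∀ᶠ j in atTop, ‖Φ (s j ^ e)‖ ≤ ‖Φ 0‖ + 1 := by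
    have h1 : Tendsto (fun j => Φ (s j ^ e)) atTop (𝓝 (Φ 0)) :=
      hΦan.continuousAt.tendsto.comp (tendsto_nhds_of_tendsto_nhdsWithin hseW)
    filter_upwards [(Metric.tendsto_nhds.1 h1) 1 one_pos] with j hj
    rw [dist_eq_norm] at hj
    linarith [norm_le_norm_add_norm_sub' (Φ (s j ^ e)) (Φ 0)]
  set tt : ℕ → ℝ := fun j => Real.exp (-(Real.log ((N₀ + j : ℕ) : ℝ)) / ((e * k : ℕ) : ℝ))
    with htt
  have htt0 : ∀ j, 0 < tt j := fun j => Real.exp_pos _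
  have hst : ∀ j, s j = ζ⁻¹ * (tt j : ℂ) * u j := by
    intro j
    rw [hs j, htt]
    simp only [Complex.ofReal_exp]
    push_cast
    ring_nf
  have hularge : ∀ᶠ j in atTop, ‖u j - 1‖ < min η₁ (1 / 2) := by
    filter_upwards [(Metric.tendsto_nhds.1 hu1) (min η₁ (1 / 2)) (lt_min hη₁ (by norm_num))]
      with j hj
    rwa [dist_eq_norm] at hj
  have hsδ : ∀ᶠ j in atTop, ‖s j‖ < δ₁ := by
    filter_upwards [(Metric.tendsto_nhds.1 hs0') δ₁ hδ₁] with j hj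
    rwa [dist_zero_right] at hj
  obtain ⟨J₀, hJ₀⟩ := Filter.eventually_atTop.1
    ((hsW.eventually hedge).and ((hseW.eventually hplace).and (hΦb.and (hularge.and hsδ))))
  have hshift : Tendsto (fun j => J₀ + j) atTop atTop :=
    (tendsto_add_atTop_nat J₀).congr fun j => Nat.add_comm j J₀
  -- Step 7: the sequence `p_j = s_{J₀ + j}^e`
  refine ⟨fun j => s (J₀ + j) ^ e, c * (‖ζ⁻¹‖ / 2) ^ (e * M), ?_, fun j => pow_ne_zero _ (hs0 _),
    ?_, fun j => (hJ₀ (J₀ + j) (Nat.le_add_right _ _)).2.1, ?_, ?_, ?_, ?_⟩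
  · have hζ0 : ζ ≠ 0 := by
      rintro rfl
      rw [zero_pow (by omega)] at hζ
      exact hz0 hζ.symm
    have : 0 < ‖ζ⁻¹‖ := norm_pos_iff.2 (inv_ne_zero hζ0)
    positivity
  · exact tendsto_nhds_of_tendsto_nhdsWithin (hseW.comp hshift)
  · -- the direction: `Re x₁ ≤ -c' |p|^{-M}`
    intro j
    obtain ⟨-, -, -, huj, hsj⟩ := hJ₀ (J₀ + j) (Nat.le_add_right _ _)
    have hre := sector_re_le (M := M) hζ hdirc (htt0 (J₀ + j)) (hst (J₀ + j)) hsj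
      (huj.trans_le (min_le_left _ _))
    obtain ⟨hra, -⟩ := sector_norm_bounds (htt0 _) (hst (J₀ + j)) (huj.trans_le (min_le_right _ _))
    have hs0j : 0 < ‖s (J₀ + j)‖ := norm_pos_iff.2 (hs0 _)
    have h1 : ‖ζ⁻¹‖ / 2 * ‖s (J₀ + j)‖⁻¹ ≤ (tt (J₀ + j))⁻¹ := by
      rw [← div_eq_mul_inv, div_le_iff₀ hs0j]
      calc ‖ζ⁻¹‖ / 2 = (tt (J₀ + j))⁻¹ * (‖ζ⁻¹‖ / 2 * tt (J₀ + j)) := by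
            field_simp [(htt0 (J₀ + j)).ne']
        _ ≤ (tt (J₀ + j))⁻¹ * ‖s (J₀ + j)‖ :=
            mul_le_mul_of_nonneg_left hra (inv_pos.2 (htt0 _)).le
    have h2 : (‖ζ⁻¹‖ / 2) ^ (e * M) * ‖s (J₀ + j)‖⁻¹ ^ (e * M) ≤ (tt (J₀ + j))⁻¹ ^ (e * M) := by
      rw [← mul_pow]
      exact pow_le_pow_left₀ (by positivity) h1 _
    have h3 := mul_le_mul_of_nonneg_left h2 hc.le
    have hR : -(c * (‖ζ⁻¹‖ / 2) ^ (e * M)) * ‖s (J₀ + j) ^ e‖⁻¹ ^ M =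
        -(c * ((‖ζ⁻¹‖ / 2) ^ (e * M) * ‖s (J₀ + j)‖⁻¹ ^ (e * M))) := by
      rw [norm_pow]
      ring
    show (Φ (s (J₀ + j) ^ e) * ((s (J₀ + j) ^ e) ^ M)⁻¹).re ≤
      -(c * (‖ζ⁻¹‖ / 2) ^ (e * M)) * ‖s (J₀ + j) ^ e‖⁻¹ ^ M
    rw [hR]
    linarith
  · -- the size: `|x₁| ≤ (|Φ(0)| + 1) |p|^{-M}`
    intro j
    obtain ⟨-, -, hΦj, -, -⟩ := hJ₀ (J₀ + j) (Nat.le_add_right _ _)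
    show ‖Φ (s (J₀ + j) ^ e) * ((s (J₀ + j) ^ e) ^ M)⁻¹‖ ≤ (‖Φ 0‖ + 1) * ‖s (J₀ + j) ^ e‖⁻¹ ^ M
    rw [norm_mul, norm_inv, norm_pow, ← inv_pow]
    exact mul_le_mul_of_nonneg_right hΦj (by positivity)
  · -- the equation
    intro j
    obtain ⟨hedgej, hFj, -, -, -⟩ := hJ₀ (J₀ + j) (Nat.le_add_right _ _)
    have hσ0 : s (J₀ + j) ≠ 0 := hs0 _
    have hsolj := hsol (J₀ + j)
    have hYfull : s (J₀ + j) ^ L * (Complex.exp ((s (J₀ + j) ^ (e * k))⁻¹) *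
        (s (J₀ + j) ^ L)⁻¹) = Complex.exp (((s (J₀ + j) ^ e) ^ k)⁻¹) := by
      rw [← pow_mul]
      field_simp
    have hedgeY := hedgej (Complex.exp ((s (J₀ + j) ^ (e * k))⁻¹) * (s (J₀ + j) ^ L)⁻¹)
    rw [← eval_eq_of_forall_dvd_sub F hTdiff hFj, hG₀ _ _ _ hFj, hYfull] at hedgeY
    have hν0 : s (J₀ + j) ^ ν ≠ 0 := zpow_ne_zero _ hσ0
    -- multiply the solved relation by `σ^ν`
    have key := congrArg (fun w => s (J₀ + j) ^ ν * w) hsolj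
    simp only [mul_zero, mul_add, hYfull] at key
    rw [← hedgeY, ← mul_assoc, mul_inv_cancel₀ hν0, one_mul, add_sub_cancel] at key
    simpa using key
  · -- the sector estimate `|Re x₀| ≤ ε |x₀|`
    intro ε hε
    have hζ0 : ζ ≠ 0 := by
      rintro rfl
      rw [zero_pow (by omega)] at hζ
      exact hz0 hζ.symm
    -- `w_j = (u_j^{ek})⁻¹ → 1`
    have hw : Tendsto (fun j => (u (J₀ + j) ^ (e * k))⁻¹) atTop (𝓝 1) := by
      have h1 : Tendsto (fun j => u (J₀ + j)) atTop (𝓝 1) := hu1.comp hshift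
      have h2 := ((continuous_pow (e * k)).continuousAt.tendsto.comp h1).inv₀ (by simp)
      simpa using h2
    have hwev : ∀ᶠ j in atTop, ‖(u (J₀ + j) ^ (e * k))⁻¹ - 1‖ < min (ε / 2) (1 / 2) := by
      have := (Metric.tendsto_nhds.1 hw) _ (lt_min (half_pos hε) (by norm_num : (0 : ℝ) < 1 / 2))
      filter_upwards [this] with j hj
      rwa [dist_eq_norm] at hj
    filter_upwards [hwev] with j hj
    set w : ℂ := (u (J₀ + j) ^ (e * k))⁻¹ with hwdef
    set R : ℝ := (tt (J₀ + j) ^ (e * k))⁻¹ with hR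
    have hR0 : 0 < R := inv_pos.2 (pow_pos (htt0 _) _)
    have hu0 : u (J₀ + j) ≠ 0 := by
      intro h0
      have h1 : ‖w - 1‖ < 1 / 2 := hj.trans_le (min_le_right _ _)
      rw [hwdef, h0, zero_pow (Nat.mul_ne_zero (by omega) hk0), inv_zero, zero_sub, norm_neg,
        norm_one] at h1
      norm_num at h1
    -- `x₀ = (p^k)⁻¹ = 2πi · R · w`
    have hx₀ : ((s (J₀ + j) ^ e) ^ k)⁻¹ = 2 * Real.pi * I * (R : ℂ) * w := by
      have httC : ((tt (J₀ + j) : ℝ) : ℂ) ≠ 0 := Complex.ofReal_ne_zero.2 (htt0 _).ne'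
      rw [← pow_mul, hst (J₀ + j), mul_pow, mul_pow, inv_pow, hζk, hwdef, hR]
      push_cast
      field_simp
    have hw1 : 1 / 2 ≤ ‖w‖ := by
      have h1 : ‖w - 1‖ < 1 / 2 := hj.trans_le (min_le_right _ _)
      have := norm_sub_norm_le (1 : ℂ) w
      rw [norm_one, norm_sub_rev] at this
      linarith
    have hwε : ‖w - 1‖ ≤ ε * ‖w‖ := by
      have h1 : ‖w - 1‖ < ε / 2 := hj.trans_le (min_le_left _ _)
      nlinarith
    have hnorm : ‖s (J₀ + j) ^ e‖⁻¹ ^ k = 2 * Real.pi * R * ‖w‖ := by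
      rw [inv_pow, ← norm_pow, ← norm_inv, hx₀]
      simp only [norm_mul, Complex.norm_real, Complex.norm_I, Real.norm_eq_abs,
        abs_of_pos Real.pi_pos, abs_of_pos hR0, Complex.norm_ofNat]
      ring
    have hre : (((s (J₀ + j) ^ e) ^ k)⁻¹).re = -(2 * Real.pi * R) * w.im := by
      rw [hx₀]
      simp only [Complex.mul_re, Complex.mul_im, Complex.I_re, Complex.I_im, Complex.ofReal_re,
        Complex.ofReal_im, Complex.re_ofNat, Complex.im_ofNat]
      ring
    show |(((s (J₀ + j) ^ e) ^ k)⁻¹).re| ≤ ε * ‖s (J₀ + j) ^ e‖⁻¹ ^ k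
    rw [hre, hnorm]
    have him : |w.im| ≤ ‖w - 1‖ := by
      have h := Complex.abs_im_le_norm (w - 1)
      rwa [Complex.sub_im, Complex.one_im, sub_zero] at h
    have h2πR : 0 ≤ 2 * Real.pi * R := by positivity
    rw [abs_mul, abs_neg, abs_of_nonneg h2πR]
    calc 2 * Real.pi * R * |w.im| ≤ 2 * Real.pi * R * (ε * ‖w‖) :=
          mul_le_mul_of_nonneg_left (him.trans hwε) h2πR
      _ = ε * (2 * Real.pi * R * ‖w‖) := by ring

end BottomEdgePointsSector

end Summit.Schanuel.Schanuel.Theorems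

end
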